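import Summits.QuantumAdvantage.QuantumAdvantage.Theorems.CubicForrelationNearExactIsExactTwelveLevelSixOffFlat136
import Summits.QuantumAdvantage.QuantumAdvantage.Theorems.CubicForrelationNearExactIsExactTwelveLevelSixH34Avoid
import Summits.QuantumAdvantage.QuantumAdvantage.Theorems.CubicForrelationNearExactIsExactTwelveLevelSixDualKill943
import Summits.QuantumAdvantage.QuantumAdvantage.Theorems.CubicForrelationNearExactIsExactTwelveLevelSixEight648
import Summits.QuantumAdvantage.QuantumAdvantage.Theorems.CubicForrelationNearExactIsExactTwelveLevelSixOnZ

/-!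
# Crux `CubicForrelation.NearExactIsExact` (stmt-QuantumAdvantage-14043) — n = 12: a level-`≥ 6` side is impossible for `943/1024 ≤ Φ < 59/64`

Certificate seat `b2b-cforr-cert` (gen 15).  HONEST FRAMING: a kernel-checked THEOREM (standard axioms) about cubic Boolean pairs on 12 bits —
the level-`≥ 6` branch of "is some `Φ ∈ [943/1024, 59/64)` attained at `n = 12`?" (tree: `θ₁₂ ∈ [57/64, 59/64)`); with
`tw15_levelFive_932_false` and `to15_typeO_le_942` it empties that window (`…TwelveClosed943.lean`).  Finite-slice statement; NOT summit progress.

THEOREM `tw15_levelSix_943_false`: cubic `f, g : 𝔽₂¹² → 𝔽₂` with `W_g ∈ 64ℤ` and `943/1024 ≤ Φ(f,g) < 59/64` do not exist.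
Proof (`W_g = 64u''`, `e = u'' − (−1)^f`, `Σ e² = 8192(1 − Φ) ≤ 648`): all `u''` odd makes `g` bent (`Φ ∈ {1} ∪ [0, 7/8]`, `tw_bent_end`);
otherwise `Z = {u'' even}` is a 9-flat with `512` points (second weight of `RM(3,12)`), `Σ_{∉Z} e² + Σ_Z (e² − 1) ≤ 136`, and
`tw15_off_flat_le136` splits: `8 ∣ e` off `Z` — gen 13's engine (`tw15_levelSix_eight_false648`); or the sparse two-coset exception with
off-flat energy `≥ 128`, hence `Σ_Z (e² − 1) ≤ 8`; (H3)/(H4) by avoidance (`tw15_H34_avoid`) first exclude a point of `Z` with `|e| = 3`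
(`tw15_onZ_no_mild_wild`), so `e = ±1` on `Z`, killed two-sidedly (`tw15_levelSix_sparse_false943`).

References: Ax (1964) / McEliece (1972); Hou (1998); Kasami–Tokura (1970); MacWilliams–Sloane (1977) Ch. 13–15; Carlet (2021) §5.2;
O'Donnell (2014) §3.3.  Everything below is proved from Mathlib and the tree; axioms are the standard three.
-/

set_option linter.dupNamespace false -- D-0017: single-problem summit ⇒ `QuantumAdvantage.QuantumAdvantage` by design

noncomputable section

namespace Summit.QuantumAdvantage.QuantumAdvantage.Theorems.CubicForrelation.NearExactIsExact

open Finset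
open Literature.Computability.QuantumComplexity
open Literature.Computability.QuantumComplexity.BuzetChailloux (bxor zeroVec bxor_bxor_cancel_left bxor_zeroVec zeroVec_bxor bxor_comm
  bxor_self)
open Literature.Computability.QuantumComplexity.DerivativeWalsh (W)

/-! ### The theorem -/

/-- **A level-`≥ 6` side is impossible for `943/1024 ≤ Φ < 59/64` on 12 bits.**  Cubic `f, g : 𝔽₂¹² → 𝔽₂` with `W_g = 64·u''` and
`943/1024 ≤ Φ(f,g) < 59/64` cannot exist.  Finite-slice statement; NOT summit progress. [this work] -/
theorem tw15_levelSix_943_false (f g : (Fin (6 + 6) → Bool) → Bool) (hf : IsDegLeFun 3 f) (hg : IsDegLeFun 3 g)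
    (u'' : (Fin (6 + 6) → Bool) → ℤ) (hu'' : ∀ x, W (fun y => signOf (g y)) x = (2 : ℝ) ^ 6 * (u'' x : ℝ))
    (hlo : (943 / 1024 : ℝ) ≤ forrelation f g) (hhi : forrelation f g < 59 / 64) : False := by
  classical
  -- `u = 4u''` at the Ax level `4`
  set u : (Fin (6 + 6) → Bool) → ℤ := fun x => 4 * u'' x with hudef
  have hu : ∀ x, W (fun y => signOf (g y)) x = (2 : ℝ) ^ 4 * (u x : ℝ) := by
    intro x; rw [hu'' x]; simp only [u]; push_cast; ring
  -- the residual `e = u'' − s` and its budget `B = Σ e² = 8192(1 − Φ) ≤ 648`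
  set e : (Fin (6 + 6) → Bool) → ℤ := fun x => u'' x - sZ (f x) with hedef
  have hFe : ∀ y, u y - 4 * sZ (f y) = 4 * e y := fun y => by simp only [u, e]; ring
  have hbud := tw12_budget f g u hu
  have h16 : ∀ x, (u x - 4 * sZ (f x)) ^ 2 = 16 * e x ^ 2 := fun x => by rw [hFe]; ring
  have hBR : ((∑ x, e x ^ 2 : ℤ) : ℝ) = 8192 * (1 - forrelation f g) := by
    have h' : ((∑ x, (u x - 4 * sZ (f x)) ^ 2 : ℤ) : ℝ) = 16 * ((∑ x, e x ^ 2 : ℤ) : ℝ) := by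
      rw [sum_congr rfl fun x _ => h16 x, ← mul_sum]; push_cast; ring
    rw [h'] at hbud
    linarith
  have hB_le : (∑ x, e x ^ 2 : ℤ) ≤ 648 := by
    have h' : ((∑ x, e x ^ 2 : ℤ) : ℝ) ≤ 648 := by rw [hBR]; linarith
    exact_mod_cast h'
  -- even points of `u''` cost `≥ 1`
  set Z := univ.filter (fun x : Fin (6 + 6) → Bool => ¬ Odd (u'' x)) with hZdef
  have hmemZ : ∀ x, x ∈ Z ↔ ¬ Odd (u'' x) := fun x => by simp [hZdef]
  have heodd : ∀ x, x ∈ Z → Odd (e x) := by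
    intro x hx
    have hev := Int.not_odd_iff_even.1 ((hmemZ x).1 hx)
    rcases tp_sZ_cases (f x) with hs | hs <;> simp only [e] <;> rw [hs]
    · exact Int.odd_sub.2 (iff_of_false (Int.not_odd_iff_even.2 hev) (by decide))
    · exact Int.odd_sub.2 (iff_of_false (Int.not_odd_iff_even.2 hev) (by decide))
  have hsq1 : ∀ x, x ∈ Z → 1 ≤ e x ^ 2 := by
    intro x hx
    have h0 := Int.odd_iff.1 (heodd x hx)
    have : e x ≤ -1 ∨ 1 ≤ e x := by omega
    have := tp_sq_ge (k := 1) (by norm_num) this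
    linarith
  have hsplit : (∑ x, e x ^ 2 : ℤ) = ∑ x ∈ Z, e x ^ 2 + ∑ x ∈ univ.filter (fun x => x ∉ Z), e x ^ 2 := by
    rw [← sum_filter_add_sum_filter_not univ (fun x => x ∈ Z)]
    congr 1
    exact sum_congr (by ext x; simp) fun _ _ => rfl
  have hZle : (#Z : ℤ) ≤ 648 := by
    have h2 : ∑ x ∈ Z, (1 : ℤ) ≤ ∑ x ∈ Z, e x ^ 2 := sum_le_sum fun x hx => hsq1 x hx
    rw [sum_const, nsmul_eq_mul, mul_one] at h2
    linarith [sum_nonneg fun x (_ : x ∈ univ.filter (fun x => x ∉ Z)) => sq_nonneg (e x)]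
  -- Parseval at level 6: `Σ u''² = 4096`
  have hpar : ∑ x, u'' x ^ 2 = 4096 := by
    have h := zms_sum_u_sq 2 g u (fun x => (hu x).trans (by norm_num))
    have e : ∑ x, ((u x : ℝ)) ^ 2 = 16 * ∑ x, ((u'' x : ℝ)) ^ 2 := by
      rw [mul_sum]; exact sum_congr rfl fun x _ => by simp only [u]; push_cast; ring
    rw [e] at h
    norm_num at h
    have h' : ∑ x, ((u'' x : ℝ)) ^ 2 = 4096 := by linarith
    exact_mod_cast h'
  by_cases hall : ∀ x, Odd (u'' x)
  · -- every `u''` odd: `g` is bent, `Φ = 1` or `Φ ≤ 7/8`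
    have hsq1' : ∀ x, u'' x ^ 2 = 1 := by
      have hge : ∀ x, (1 : ℤ) ≤ u'' x ^ 2 := fun x => by
        have h0 := Int.odd_iff.1 (hall x)
        have : u'' x ≤ -1 ∨ 1 ≤ u'' x := by omega
        have := tp_sq_ge (k := 1) (by norm_num) this
        linarith
      have hsum0 : ∑ x, (u'' x ^ 2 - 1 : ℤ) = 0 := by
        rw [sum_sub_distrib, hpar, sum_const, card_univ, Fintype.card_fun, Fintype.card_bool, Fintype.card_fin]; norm_num
      intro x
      have := (sum_eq_zero_iff_of_nonneg fun y _ => by have := hge y; linarith).1 hsum0 x (mem_univ x)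
      linarith
    have hbent : ∀ x, W (fun y => signOf (g y)) x ^ 2 = (2 : ℝ) ^ (6 + 6) := by
      intro x
      rw [hu'' x, mul_pow]
      have : ((u'' x : ℝ)) ^ 2 = 1 := by exact_mod_cast hsq1' x
      rw [this]; norm_num
    rcases tw_bent_end (by norm_num) f g hf hg hbent with h | h
    · rw [h] at hhi; norm_num at hhi
    · linarith
  push Not at hall
  obtain ⟨x₁, hx₁⟩ := hall
  -- the parity of `u''` is cubic; `Z` has exactly `512` points and is a 9-flat
  have hp : IsDegLeFun 3 (fun x => decide (Odd (u'' x))) :=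
    stub_walshTower stub_axParity (6 + 6) 6 3 g u'' hg hu'' (by intro k hk hkn; omega)
  have hp' : IsDegLeFun (2 + 1) (fun x => decide (Odd (u'' x)) ^^ true) := tb_isDegLeFun_xor_const hp true
  have hfilt : (univ.filter fun x : Fin (6 + 6) → Bool => (decide (Odd (u'' x)) ^^ true) = true) = Z :=
    filter_congr fun x _ => by simp
  have hne : ∃ x, (decide (Odd (u'' x)) ^^ true) = true := ⟨x₁, by simpa using hx₁⟩
  have hRM := bb_rmWeight_holds (6 + 6) 3 (fun x => decide (Odd (u'' x)) ^^ true) hp' hne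
  rw [hfilt] at hRM
  have hZge : 512 ≤ #Z := by norm_num at hRM; omega
  have hZcard : #Z = 512 := by
    have hZle' : #Z ≤ 648 := by exact_mod_cast hZle
    have hsw := sw_cubic_second_weight (m := 6 + 6) _ hp' hne (by rw [hfilt]; norm_num; omega)
    rw [hfilt] at hsw
    norm_num at hsw
    omega
  have hmw := mw_flat_of_minweight 2 (fun x => decide (Odd (u'' x)) ^^ true) hp' (by rw [hfilt, hZcard]; norm_num)
  rw [hfilt] at hmw
  obtain ⟨h0, hadd, hcardV, hcoset⟩ := hmw
  set V₀ := univ.filter (fun a : Fin (6 + 6) → Bool => ∀ x,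
    (decide (Odd (u'' (bxor x a))) ^^ true) = (decide (Odd (u'' x)) ^^ true)) with hV₀
  obtain ⟨xZ, hxZ⟩ : Z.Nonempty := card_pos.1 (by rw [hZcard]; norm_num)
  have hS : Z = V₀.image (bxor xZ) := hcoset xZ (by have h := (hmemZ xZ).1 hxZ; simpa using h)
  rw [hZcard] at hcardV
  have hcardV9 : #V₀ = 2 ^ 9 := by rw [hcardV]; norm_num
  have hPV : ∀ x, x ∈ Z → ∀ a ∈ V₀, bxor x a ∈ Z := fun x hx a ha => fl1_coset_vadd hadd hS hx ha
  have hPV' : ∀ x, x ∉ Z → ∀ a ∈ V₀, bxor x a ∉ Z := fun x hx a ha => fl1_coset_out' hadd hS hx ha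
  -- budget split: `Σ_Z e² ≥ 512`, so off `Z` at most `136`
  have hZsum_ge : (512 : ℤ) ≤ ∑ x ∈ Z, e x ^ 2 := by
    have h1 : ∑ x ∈ Z, (1 : ℤ) ≤ ∑ x ∈ Z, e x ^ 2 := sum_le_sum fun x hx => hsq1 x hx
    rw [sum_const, nsmul_eq_mul, mul_one, hZcard] at h1
    exact_mod_cast h1
  have hoff_le : ∑ x ∈ univ.filter (fun x => x ∉ Z), e x ^ 2 ≤ 136 := by linarith
  rcases tw15_off_flat_le136 f g hf hg u'' hu'' V₀ xZ h0 hadd hcardV9 hS hoff_le with h8 | ⟨y₁, y₂, hy₁, hy₂, hy₁₂, hoff, hc₁, hc₂, h128⟩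
  · /- `8 ∣ e` off `Z`: gen 13's engine with the closed budget -/
    exact tw15_levelSix_eight_false648 f g hf hg u'' hu'' hB_le V₀ xZ h0 hadd hcardV hS h8
  · /- the sparse exception: `Σ_Z (e² − 1) ≤ 8`, (H3)/(H4) by avoidance, no `|e| = 3` on `Z`, then the two-sided kill -/
    have hDZ : ∑ x ∈ Z, (e x ^ 2 - 1) ≤ 8 := by
      rw [sum_sub_distrib, sum_const, nsmul_eq_mul, mul_one, hZcard]
      push_cast
      linarith
    obtain ⟨H3, H4⟩ := tw15_H34_avoid f g hf hg u'' hu'' V₀ xZ h0 hadd hcardV hS y₁ y₂ hy₁ hy₂ hy₁₂ hoff hc₁ hc₂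
    have hmild := tw15_onZ_no_mild_wild f u'' V₀ xZ h0 hadd hcardV hS (by linarith) H3 H4
    have hZ1 : ∀ x ∈ Z, e x ^ 2 = 1 := by
      intro x hx
      rcases hmild x hx with h1 | h49
      · exact h1
      · exfalso
        have h2 : e x ^ 2 - 1 ≤ ∑ y ∈ Z, (e y ^ 2 - 1) :=
          single_le_sum (f := fun y => e y ^ 2 - 1) (fun y hy => by linarith [hsq1 y hy]) hx
        change 49 ≤ e x ^ 2 at h49
        linarith
    exact tw15_levelSix_sparse_false943 f g hf hg u'' hu'' hlo (by linarith) V₀ xZ h0 hadd hcardV hS hZ1 hoff_le H3 H4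

end Summit.QuantumAdvantage.QuantumAdvantage.Theorems.CubicForrelation.NearExactIsExact

end
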